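import Literature.AlgebraicGeometry.Resolution.BlowupExceptionalFibreIrreducible
import Literature.AlgebraicGeometry.Motives.AbelianVarietyBlochGrVanishing
import HarnessLib

/-!
# The fibre of a blowing up over a point `y` of the centre with `J_y = 𝔪_y` regular of dimension `≥ 2` has at least two points

Topic: `Literature/AlgebraicGeometry/Resolution`. Companion of `BlowupExceptionalFibreIrreducible` (same construction, same sources):
for a blowing up `π : X' → X` (`IsBlowup π J`) and a point `y` with regular local ring `𝒪_{X,y}` of dimension `≥ 2` at which the
blown-up ideal has stalk `J_y = 𝔪_y` (e.g. the blowing up of a closed point of a regular surface), the fibre `π⁻¹(y)` is NOT a single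
point — it is the injective image of `ℙ^{m−1}_{κ(y)}`, `m = dim 𝒪_{X,y} ≥ 2`, which has a generic point of height `m − 1 ≥ 1`
(`ProjSpace.height_genericPoint_eq`) besides its closed points.  With `IsBlowup.isIrreducible_preimage_singleton` this says: the fibre is an
irreducible closed set whose generic point is NOT closed, i.e. a positive-dimensional exceptional CURVE/variety — the form in which the
exceptional divisor of the blowing up of a point enters the bookkeeping of exceptional curves (Lipman 1969, (B1) split core of crux
`NoZenoR`: the node curves of `X¹ = Bl_{nodes} X`).

* `affineBlowup.nontrivial_preimage_of_isQuasiRegular` — affine model: for a quasi-regular `c = (c₀, …, c_{r+1})` (length `≥ 2`) generating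
  a maximal ideal of `R`, the fibre of `Bl_{(c)} Spec R → Spec R` over `(c)` has two distinct points (it is `ℙ^{r+1}_{R/(c)}`, embedded);
* `IsBlowup.nontrivial_preimage_singleton` — the scheme statement (base change to `Spec 𝒪_{X,y}`, `IsBlowup.pullback_snd_of_flat`,
  uniqueness of blowing ups, and the preimmersion `X' ×_X Spec 𝒪_{X,y} → X'`);
* `IsBlowup.not_isClosed_genericPoint_preimage_singleton`, `IsBlowup.exists_specializes_ne_of_mem_preimage` — convenient forms: the generic
  point `η` of the (irreducible, closed) fibre is not a closed point; some point of the fibre is a proper specialisation of `η`.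

All PROVED [folklore]. Sources: R. Hartshorne, *Algebraic Geometry* (1977), II Thm. 8.24 (b) [Hartshorne1977]; Q. Liu, *Algebraic Geometry
and Arithmetic Curves* (2002), Thm. 8.1.19 (b) [Liu2002]; The Stacks Project, Tags 0804, 01J7 [StacksProject].
-/

noncomputable section

open CategoryTheory CategoryTheory.Limits AlgebraicGeometry TopologicalSpace IsLocalRing HomogeneousLocalization
open Literature.AlgebraicGeometry.Motives Literature.AlgebraicGeometry.Motives.ProjBaseChangeRing

namespace Literature.AlgebraicGeometry.Resolution

universe u

open Scheme.IdealSheafData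

/-- **The exceptional fibre of the affine model has two points**: for a quasi-regular sequence `c = (c₀, …, c_{r+1})` of length
`≥ 2` in a ring `R` generating a MAXIMAL ideal, the fibre of `Bl_{(c)}(Spec R) → Spec R` over the point `(c)` contains two distinct
points (it is `ℙ^{r+1}_{R/(c)}` embedded by a closed immersion, and `ℙ^{r+1}` over a field has a non-closed generic point).
[cite: Hartshorne1977, II Thm. 8.24 (b)] -/
theorem affineBlowup.nontrivial_preimage_of_isQuasiRegular {R : Type u} [CommRing R] {r : ℕ}
    (c : Fin (r + 1 + 1) → R) (hc : IsQuasiRegular c) (hmax : (Ideal.span (Set.range c)).IsMaximal) :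
    ((affineBlowup.π (Ideal.span (Set.range c))) ⁻¹'
      {(⟨Ideal.span (Set.range c), hmax.isPrime⟩ : PrimeSpectrum R)}).Nontrivial := by
  classical
  letI : Field (R ⧸ Ideal.span (Set.range c)) := Ideal.Quotient.field _
  -- the standard grading of `(R/𝔪)[T₀, …, T_{r+1}]` (local instance inside this proof only)
  letI : GradedRing (MvPolynomial.homogeneousSubmodule (Fin (r + 1 + 1)) (R ⧸ Ideal.span (Set.range c))) :=
    MvPolynomial.gradedAlgebra
  -- the closed immersion `j : Spec (R/𝔪) → Spec R` with kernel the ideal sheaf of `𝔪`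
  haveI : IsClosedImmersion (Spec.map (CommRingCat.ofHom (Ideal.Quotient.mk (Ideal.span (Set.range c))))) :=
    IsClosedImmersion.spec_of_surjective _ Ideal.Quotient.mk_surjective
  have hjker : (Spec.map (CommRingCat.ofHom (Ideal.Quotient.mk (Ideal.span (Set.range c))))).ker =
      affineBlowup.idealSheaf (Ideal.span (Set.range c)) := by
    rw [ker_specMap_eq_idealSheaf, Ideal.mk_ker]
  -- the exceptional fibre `E = Bl ×_{Spec R} Spec (R/𝔪)` is `ℙ^{r+1}_{R/𝔪}`
  have h1 := isPullback_exceptional_projectiveSpace c _ hjker hc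
  have h2 := isPullback_projMap' R (R ⧸ Ideal.span (Set.range c)) (n := r + 1)
  rw [Ideal.Quotient.algebraMap_eq] at h2
  let e := h1.isoIsPullback _ _ h2
  -- `ℙ^{r+1}` over a field is irreducible with generic point of height `r + 1 ≥ 1`: it has two distinct points
  haveI : IrreducibleSpace
      ↑(Proj (MvPolynomial.homogeneousSubmodule (Fin (r + 1 + 1)) (R ⧸ Ideal.span (Set.range c)))) :=
    Proj.irreducibleSpace _ (by
      intro h
      have hx : (MvPolynomial.X 0 : MvPolynomial (Fin (r + 1 + 1)) (R ⧸ Ideal.span (Set.range c))) ∈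
          (HomogeneousIdeal.irrelevant
            (MvPolynomial.homogeneousSubmodule (Fin (r + 1 + 1)) (R ⧸ Ideal.span (Set.range c)))).toIdeal :=
        HomogeneousIdeal.mem_irrelevant_of_mem _ zero_lt_one (MvPolynomial.isHomogeneous_X _ 0)
      rw [h] at hx
      exact MvPolynomial.X_ne_zero 0 ((Submodule.mem_bot _).1 hx))
  have hP : (Set.univ :
      Set ↑(Proj (MvPolynomial.homogeneousSubmodule (Fin (r + 1 + 1)) (R ⧸ Ideal.span (Set.range c))))).Nontrivial := by
    have hh : Order.height
        (_root_.genericPoint ↑(Proj (MvPolynomial.homogeneousSubmodule (Fin (r + 1 + 1)) (R ⧸ Ideal.span (Set.range c))))) =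
          ((r + 1 : ℕ) : ℕ∞) :=
      ProjSpace.height_genericPoint_eq (K := R ⧸ Ideal.span (Set.range c)) (r + 1)
    have hnotmin : ¬ IsMin
        (_root_.genericPoint ↑(Proj (MvPolynomial.homogeneousSubmodule (Fin (r + 1 + 1)) (R ⧸ Ideal.span (Set.range c))))) := by
      rw [← Order.height_ne_zero, hh]
      exact_mod_cast Nat.succ_ne_zero r
    obtain ⟨q, hq⟩ := not_isMin_iff.mp hnotmin
    exact ⟨q, Set.mem_univ _, _, Set.mem_univ _, hq.ne⟩
  -- the fibre is the (injective) image of `ℙ^{r+1}`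
  have hrange : Set.range (Spec.map (CommRingCat.ofHom (Ideal.Quotient.mk (Ideal.span (Set.range c))))) =
      {(⟨Ideal.span (Set.range c), hmax.isPrime⟩ : PrimeSpectrum R)} := by
    refine Set.eq_singleton_iff_unique_mem.mpr ⟨⟨⟨⊥, Ideal.isPrime_bot⟩, ?_⟩, ?_⟩
    · apply PrimeSpectrum.ext
      rw [Spec.map_apply, CommRingCat.hom_ofHom, PrimeSpectrum.comap_asIdeal, ← RingHom.ker_eq_comap_bot,
        Ideal.mk_ker]
    · rintro _ ⟨q, rfl⟩
      apply PrimeSpectrum.ext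
      have hle : Ideal.span (Set.range c) ≤
          (Spec.map (CommRingCat.ofHom (Ideal.Quotient.mk (Ideal.span (Set.range c)))) q).asIdeal := by
        intro a ha
        rw [Spec.map_apply, CommRingCat.hom_ofHom, PrimeSpectrum.comap_asIdeal, Ideal.mem_comap,
          Ideal.Quotient.eq_zero_iff_mem.mpr ha]
        exact zero_mem _
      exact (hmax.eq_of_le (PrimeSpectrum.isPrime _).ne_top hle).symm
  rw [← hrange, ← Scheme.Pullback.range_fst]
  have hsurj : Function.Surjective e.inv := (Scheme.homeoOfIso e.symm).surjective
  have himg : Set.range (pullback.fst (affineBlowup.π (Ideal.span (Set.range c)))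
      (Spec.map (CommRingCat.ofHom (Ideal.Quotient.mk (Ideal.span (Set.range c)))))) =
      (fun z => pullback.fst (affineBlowup.π (Ideal.span (Set.range c)))
        (Spec.map (CommRingCat.ofHom (Ideal.Quotient.mk (Ideal.span (Set.range c))))) (e.inv z)) ''
        Set.univ := by
    rw [Set.image_univ]
    ext w
    constructor
    · rintro ⟨z, rfl⟩
      obtain ⟨z', rfl⟩ := hsurj z
      exact ⟨z', rfl⟩
    · rintro ⟨z', rfl⟩
      exact ⟨_, rfl⟩
  rw [himg]
  refine hP.image ?_
  exact (pullback.fst (affineBlowup.π (Ideal.span (Set.range c)))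
      (Spec.map (CommRingCat.ofHom (Ideal.Quotient.mk (Ideal.span (Set.range c)))))).isClosedEmbedding.injective.comp
    (Scheme.homeoOfIso e.symm).injective

/-- **The fibre of a blowing up over a point `y` with `𝒪_{X,y}` regular of dimension `≥ 2` and `J_y = 𝔪_y` has at least two
points** (it is a `ℙ^{m−1}`, `m ≥ 2`, over `κ(y)`, embedded). [cite: Hartshorne1977, II Thm. 8.24 (b)] -/
theorem IsBlowup.nontrivial_preimage_singleton {X X' : Scheme.{u}} {π : X' ⟶ X} {J : X.IdealSheafData}
    (hπ : IsBlowup π J) (y : X) [IsRegularLocalRing (X.presheaf.stalk y)]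
    (hy : stalkIdeal J y = maximalIdeal (X.presheaf.stalk y))
    (h2 : 2 ≤ ringKrullDim (X.presheaf.stalk y)) :
    (π ⁻¹' {y}).Nontrivial := by
  classical
  -- quasi-regular generators `c` of `𝔪_y`
  letI : Field (X.presheaf.stalk y ⧸ maximalIdeal (X.presheaf.stalk y)) := Ideal.Quotient.field _
  obtain ⟨k, c, -, hcspan, hcq, -⟩ :=
    exists_isQuasiRegular_span_eq_of_isRegularLocalRing_quotient (le_refl (maximalIdeal (X.presheaf.stalk y)))
      (maximalIdeal (X.presheaf.stalk y) : Set (X.presheaf.stalk y)) (Ideal.span_eq _)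
  -- at least two of them, since `dim 𝒪_{X,y} ≥ 2`
  have hdim := ringKrullDim_le_spanFinrank_maximalIdeal (X.presheaf.stalk y)
  obtain ⟨r, rfl⟩ : ∃ r, k = r + 1 + 1 := by
    rcases Nat.lt_or_ge k 2 with hk | hk
    · exfalso
      have hsf : (maximalIdeal (X.presheaf.stalk y)).spanFinrank ≤ 1 := by
        rcases Nat.lt_or_ge k 1 with hk0 | hk1
        · have : k = 0 := by omega
          subst this
          rw [← hcspan, Set.range_eq_empty, Ideal.span_empty]
          simp
        · have : k = 1 := by omega
          subst this
          rw [← hcspan, Set.range_unique]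
          exact (Submodule.spanFinrank_span_le_ncard_of_finite (Set.finite_singleton _)).trans
            (by rw [Set.ncard_singleton])
      have h21 : (2 : WithBot ℕ∞) ≤ ((1 : ℕ) : WithBot ℕ∞) :=
        h2.trans (hdim.trans (by exact_mod_cast hsf))
      exact absurd h21 (by decide)
    · exact ⟨k - 2, by omega⟩
  have hmax : (Ideal.span (Set.range c)).IsMaximal := hcspan ▸ inferInstance
  -- base change to `Spec 𝒪_{X,y}`: a blowing up along `(𝔪_y)~`, hence `≅ Proj 𝒪_{X,y}[𝔪 t]`
  haveI : Flat (X.fromSpecStalk y) := flat_fromSpecStalk X y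
  have hP : IsBlowup (pullback.snd π (X.fromSpecStalk y)) (affineBlowup.idealSheaf (Ideal.span (Set.range c))) := by
    have h := hπ.pullback_snd_of_flat (X.fromSpecStalk y)
    rwa [comap_fromSpecStalk_eq_affineBlowupIdealSheaf, hy, ← hcspan] at h
  obtain ⟨e, he, -⟩ := (affineBlowup.isBlowup (Ideal.span (Set.range c))).unique hP
  -- the fibre over `y` is the image of the fibre of the affine model over the closed point
  have hclosed : (⟨Ideal.span (Set.range c), hmax.isPrime⟩ : PrimeSpectrum (X.presheaf.stalk y)) =
      closedPoint (X.presheaf.stalk y) := by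
    apply PrimeSpectrum.ext
    exact hcspan
  have hfib := affineBlowup.nontrivial_preimage_of_isQuasiRegular c hcq hmax
  rw [hclosed] at hfib
  have himage : π ⁻¹' {y} =
      (fun a => pullback.fst π (X.fromSpecStalk y) (e.hom a)) ''
        ((affineBlowup.π (Ideal.span (Set.range c))) ⁻¹' {closedPoint (X.presheaf.stalk y)}) := by
    ext x'
    constructor
    · intro hx'
      rw [Set.mem_preimage, Set.mem_singleton_iff] at hx'
      obtain ⟨z, hz⟩ := mem_range_pullback_fst_fromSpecStalk_of_eq π y (x' := x') hx'
      obtain ⟨a, rfl⟩ := (Scheme.homeoOfIso e).surjective z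
      refine ⟨a, ?_, hz⟩
      change affineBlowup.π (Ideal.span (Set.range c)) a = closedPoint (X.presheaf.stalk y)
      apply (X.fromSpecStalk y).isEmbedding.injective
      rw [Scheme.fromSpecStalk_closedPoint, ← he, Scheme.Hom.comp_apply, ← Scheme.Hom.comp_apply,
        ← pullback.condition, Scheme.Hom.comp_apply]
      rw [← Scheme.homeoOfIso_apply, hz, hx']
    · rintro ⟨a, ha, rfl⟩
      have ha' : affineBlowup.π (Ideal.span (Set.range c)) a = closedPoint (X.presheaf.stalk y) := ha
      change (e.hom ≫ pullback.fst π (X.fromSpecStalk y) ≫ π) a = y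
      rw [pullback.condition, ← Category.assoc, he, Scheme.Hom.comp_apply, ha',
        Scheme.fromSpecStalk_closedPoint]
  rw [himage]
  refine hfib.image ?_
  exact (pullback.fst π (X.fromSpecStalk y)).isEmbedding.injective.comp (Scheme.homeoOfIso e).injective

/-- **The generic point of the exceptional fibre is not a closed point** (`dim 𝒪_{X,y} ≥ 2`, `J_y = 𝔪_y`, `𝒪_{X,y}` regular): the fibre
`π⁻¹(y)` is irreducible (`IsBlowup.isIrreducible_preimage_singleton`) with at least two points. [cite: Liu2002, Thm. 8.1.19 (b)] -/
theorem IsBlowup.exists_specializes_ne_of_mem_preimage {X X' : Scheme.{u}} {π : X' ⟶ X} {J : X.IdealSheafData}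
    (hπ : IsBlowup π J) (y : X) [IsRegularLocalRing (X.presheaf.stalk y)]
    (hy : stalkIdeal J y = maximalIdeal (X.presheaf.stalk y))
    (h2 : 2 ≤ ringKrullDim (X.presheaf.stalk y)) (hyc : IsClosed ({y} : Set X)) :
    ∃ η x' : X', π ⁻¹' {y} = closure {η} ∧ x' ∈ π ⁻¹' {y} ∧ η ⤳ x' ∧ x' ≠ η := by
  have hne : maximalIdeal (X.presheaf.stalk y) ≠ ⊥ := by
    intro hbot
    have h0 : ringKrullDim (X.presheaf.stalk y) = 0 :=
      ringKrullDim_eq_zero_of_isField ((isField_iff_maximalIdeal_eq).mpr hbot)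
    rw [h0] at h2
    exact absurd h2 (by decide)
  have hirr := hπ.isIrreducible_preimage_singleton y hy hne
  have hcl : IsClosed (π ⁻¹' {y}) := hyc.preimage π.base.hom.continuous
  have hfib : π ⁻¹' {y} = closure {hirr.genericPoint} := (hirr.closure_genericPoint hcl).symm
  obtain ⟨x', hx', hx'ne⟩ := (hπ.nontrivial_preimage_singleton y hy h2).exists_ne hirr.genericPoint
  refine ⟨hirr.genericPoint, x', hfib, hx', ?_, hx'ne⟩
  rw [hfib] at hx'
  exact specializes_iff_mem_closure.mpr hx'

end Literature.AlgebraicGeometry.Resolution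

end
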